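import Summits.QuantumAdvantage.QuantumAdvantage.Theorems.CubicForrelationNearExactIsExactAmmCeilingW

/-!
# Crux `CubicForrelation.NearExactIsExact` (stmt-QuantumAdvantage-14043) — almost-MM ceiling, part V:
the case `Z = ∅` — fibres are corner flats, the fibre sum is `2K` minus mismatches, mismatches propagate

Line `direct-sum-amplification`, lead c3 (sixth helper file for the registered stub `stub_ammCeiling`).
Notation as in parts Q–Z (`K = 2^{a+2}`, polar entries `B x₁ i j`, `d x₁ j = f(x₁‖e_j) ⊕ f(x₁‖0)`, corners
`corner_{στ} = a′ ⊕ σ r_p ⊕ τ r_q`).  When every `x₁` has some `B_{pq}(x₁) = 1` and every corner lies in its fibre: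
* `acv_fibre_eq_corners`: all fibres have exactly four points and ARE the corner flats (the corner sets are
  4-subsets of the fibres and the fibres partition `𝔽₂^{a+2}`, of size `4·2^a`);
* `acv_gamma_eq`: `Γ(x₁) = (K/2)·Σ_{στ} (−1)^{m_{στ}(x₁)}` with the MISMATCH bits
  `m_{στ} = h(corner_{στ}) ⊕ f(x₁‖0) ⊕ στ` (Walsh values of the aligned slice on its corners);
* `acv_mismatch_many`: a single mismatch `m_{στ}(x*) = 1` at a fibre with `B_{pq}(x*) = 1` forces
  `2^a ≤ 128·#{x₁ : B_{pq}(x₁) = 1 ∧ m_{στ}(x₁) = 1}` (the indicator has degree `≤ 7` in `x₁`; stub R).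

References: C. Carlet, *Boolean Functions for Cryptography and Coding Theory* (CUP 2021), §5.1;
F. J. MacWilliams, N. J. A. Sloane, *The Theory of Error-Correcting Codes* (1977), Ch. 13.
-/

set_option linter.dupNamespace false -- D-0017: single-problem summit ⇒ `QuantumAdvantage.QuantumAdvantage` by design

noncomputable section

namespace Summit.QuantumAdvantage.QuantumAdvantage.Theorems.CubicForrelation.NearExactIsExact

open Finset
open Literature.Computability.QuantumComplexity
open Literature.Computability.QuantumComplexity.BuzetChailloux (bxor zeroVec signOf_sq bxor_zeroVec zeroVec_bxor
  bxor_comm bxor_self bxor_bxor_cancel_left twist_zeroVec_right twist_bxor_right sum_twist_left bxor_eq_zeroVec_iff)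
open Literature.Computability.QuantumComplexity.DerivativeWalsh (W signOf_not)

variable {a : ℕ}

section ZEmpty

variable {f : (Fin (a + (a + 2)) → Bool) → Bool} (φ : (Fin (a + 2) → Bool) → (Fin a → Bool))
  (h : (Fin (a + 2) → Bool) → Bool)
  (B : (Fin a → Bool) → Fin (a + 2) → Fin (a + 2) → Bool)
  (d : (Fin a → Bool) → Fin (a + 2) → Bool)

/-- The corner map `(σ, τ) ↦ a′ ⊕ σ r_p ⊕ τ r_q` is injective when `B_{pq} = 1` (`B` symmetric, zero diagonal). -/
theorem acv_corner_injective (hBsymm : ∀ x i j, B x i j = B x j i) (hBdiag : ∀ x i, B x i i = false)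
    (x : Fin a → Bool) {p q : Fin (a + 2)} (hpq : B x p q = true) :
    Function.Injective (fun st : Bool × Bool => fun j =>
      (d x j ^^ (B x p j && B x q j)) ^^ (st.1 && B x p j) ^^ (st.2 && B x q j)) := by
  rintro ⟨σ, τ⟩ ⟨σ', τ'⟩ e
  have ep := congrFun e p
  have eq := congrFun e q
  simp only [hBdiag x p, hBdiag x q, hBsymm x q p, hpq] at ep eq
  revert ep eq
  cases σ <;> cases τ <;> cases σ' <;> cases τ' <;> cases d x p <;> cases d x q <;> simp

/-- **Fibres are the corner flats** (`Z = ∅`): if every `x₁` has some `B_{pq}(x₁) = 1` and every corner lies in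
its fibre, then every fibre has exactly four points and equals the corner set for ANY valid `(p, q)`. -/
theorem acv_fibre_eq_corners
    (hB : ∀ x₁ i j, B x₁ i j = (f (Fin.append x₁ zeroVec) ^^ f (Fin.append x₁ (Pi.single i true)) ^^
      f (Fin.append x₁ (Pi.single j true)) ^^ f (Fin.append x₁ (bxor (Pi.single i true) (Pi.single j true)))))
    (hcm : ∀ (x₁ : Fin a → Bool) (p q : Fin (a + 2)), B x₁ p q = true → ∀ σ τ : Bool,
      φ (fun j => (d x₁ j ^^ (B x₁ p j && B x₁ q j)) ^^ (σ && B x₁ p j) ^^ (τ && B x₁ q j)) = x₁)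
    (hZ0 : ∀ x₁, ∃ p q, B x₁ p q = true) (x₁ : Fin a → Bool) {p q : Fin (a + 2)} (hpq : B x₁ p q = true) :
    (univ.filter fun y : Fin (a + 2) → Bool => φ y = x₁) =
      univ.image (fun st : Bool × Bool => fun j =>
        (d x₁ j ^^ (B x₁ p j && B x₁ q j)) ^^ (st.1 && B x₁ p j) ^^ (st.2 && B x₁ q j)) := by
  classical
  have hBsymm : ∀ x i j, B x i j = B x j i := fun x i j => by
    rw [hB, hB, bxor_comm (Pi.single i true)]
    cases f (Fin.append x zeroVec) <;> cases f (Fin.append x (Pi.single i true)) <;> cases f (Fin.append x (Pi.single j true)) <;>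
      cases f (Fin.append x (bxor (Pi.single j true) (Pi.single i true))) <;> decide
  have hBdiag : ∀ x i, B x i i = false := fun x i => by
    rw [hB, bxor_self]; cases f (Fin.append x zeroVec) <;> cases f (Fin.append x (Pi.single i true)) <;> decide
  -- corner sets are 4-subsets of the fibres
  have hsub : ∀ x (p q : Fin (a + 2)), B x p q = true →
      univ.image (fun st : Bool × Bool => fun j => (d x j ^^ (B x p j && B x q j)) ^^ (st.1 && B x p j) ^^ (st.2 && B x q j)) ⊆
        univ.filter fun y : Fin (a + 2) → Bool => φ y = x := by
    intro x p q hx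
    exact image_subset_iff.2 fun st _ => mem_filter.2 ⟨mem_univ _, hcm x p q hx st.1 st.2⟩
  have hcard4 : ∀ x (p q : Fin (a + 2)), B x p q = true →
      (univ.image (fun st : Bool × Bool => fun j => (d x j ^^ (B x p j && B x q j)) ^^ (st.1 && B x p j) ^^ (st.2 && B x q j))).card = 4 := by
    intro x p q hx
    rw [card_image_of_injective _ (acv_corner_injective B d hBsymm hBdiag x hx), card_univ, Fintype.card_prod,
      Fintype.card_bool]
  have hge : ∀ x, 4 ≤ (univ.filter fun y : Fin (a + 2) → Bool => φ y = x).card := by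
    intro x
    obtain ⟨p', q', hx⟩ := hZ0 x
    rw [← hcard4 x p' q' hx]
    exact card_le_card (hsub x p' q' hx)
  -- the fibres partition 𝔽₂^{a+2}: total 4·2^a, so each fibre has exactly 4 points
  have htot : ∑ x : Fin a → Bool, (univ.filter fun y : Fin (a + 2) → Bool => φ y = x).card = 2 ^ (a + 2) := by
    rw [← card_eq_sum_card_fiberwise (fun y _ => mem_univ (φ y)), card_univ, Fintype.card_fun, Fintype.card_bool,
      Fintype.card_fin]
  have heq : ∀ x, (univ.filter fun y : Fin (a + 2) → Bool => φ y = x).card = 4 := by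
    have hsum : ∑ x : Fin a → Bool, ((univ.filter fun y : Fin (a + 2) → Bool => φ y = x).card - 4) = 0 := by
      have e1 : ∑ x : Fin a → Bool, (univ.filter fun y : Fin (a + 2) → Bool => φ y = x).card =
          ∑ x : Fin a → Bool, (((univ.filter fun y : Fin (a + 2) → Bool => φ y = x).card - 4) + 4) :=
        sum_congr rfl fun x _ => (Nat.sub_add_cancel (hge x)).symm
      rw [sum_add_distrib, sum_const, card_univ, Fintype.card_fun, Fintype.card_bool, Fintype.card_fin,
        smul_eq_mul, htot] at e1
      have : 2 ^ (a + 2) = 2 ^ a * 4 := by ring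
      omega
    intro x
    have := (sum_eq_zero_iff.1 hsum) x (mem_univ x)
    have := hge x
    omega
  symm
  exact eq_of_subset_of_card_le (hsub x₁ p q hpq) (by rw [heq x₁, hcard4 x₁ p q hpq])

/-- **The fibre sum on a corner flat.** If the slice at `x₁` is quadratic, Plücker holds, `B_{pq}(x₁) = 1` and the
fibre is the corner set, then `Γ(x₁) = (K/2)·Σ_{στ} (−1)^{h(corner_{στ}) ⊕ f(x₁‖0) ⊕ στ}`. [cite: Carlet2020, §5.1] -/
theorem acv_gamma_eq (l : (Fin (a + 2) → Bool) → (Fin (a + 2) → Bool) → Bool) (hl : ∀ y x, signOf (l y x) = twist x y)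
    (hB : ∀ x₁ i j, B x₁ i j = (f (Fin.append x₁ zeroVec) ^^ f (Fin.append x₁ (Pi.single i true)) ^^
      f (Fin.append x₁ (Pi.single j true)) ^^ f (Fin.append x₁ (bxor (Pi.single i true) (Pi.single j true)))))
    (hd : ∀ x₁ j, d x₁ j = (f (Fin.append x₁ (Pi.single j true)) ^^ f (Fin.append x₁ zeroVec)))
    (hPl : ∀ x₁ i j i' j', ((B x₁ i j && B x₁ i' j') ^^ (B x₁ i i' && B x₁ j j') ^^ (B x₁ i j' && B x₁ j i')) = false)
    (hq : ∀ x₁, IsDegLeFun 2 (fun x₂ : Fin (a + 2) → Bool => f (Fin.append x₁ x₂)))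
    (x₁ : Fin a → Bool) {p q : Fin (a + 2)} (hpq : B x₁ p q = true)
    (hfib : (univ.filter fun y : Fin (a + 2) → Bool => φ y = x₁) =
      univ.image (fun st : Bool × Bool => fun j =>
        (d x₁ j ^^ (B x₁ p j && B x₁ q j)) ^^ (st.1 && B x₁ p j) ^^ (st.2 && B x₁ q j))) :
    ∑ y ∈ univ.filter (fun y : Fin (a + 2) → Bool => φ y = x₁), signOf (h y) * W (fun x₂ => signOf (f (Fin.append x₁ x₂))) y =
      (2 : ℝ) ^ (a + 2) / 2 * ∑ st : Bool × Bool,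
        signOf (h (fun j => (d x₁ j ^^ (B x₁ p j && B x₁ q j)) ^^ (st.1 && B x₁ p j) ^^ (st.2 && B x₁ q j)) ^^
          f (Fin.append x₁ zeroVec) ^^ (st.1 && st.2)) := by
  classical
  have hBsymm : ∀ x i j, B x i j = B x j i := fun x i j => by
    rw [hB, hB, bxor_comm (Pi.single i true)]
    cases f (Fin.append x zeroVec) <;> cases f (Fin.append x (Pi.single i true)) <;> cases f (Fin.append x (Pi.single j true)) <;>
      cases f (Fin.append x (bxor (Pi.single j true) (Pi.single i true))) <;> decide
  have hBdiag : ∀ x i, B x i i = false := fun x i => by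
    rw [hB, bxor_self]; cases f (Fin.append x zeroVec) <;> cases f (Fin.append x (Pi.single i true)) <;> decide
  -- normal form of the slice (as in part W)
  have hP' := hPl x₁
  simp only [hB] at hP'
  have hx' := hpq
  rw [hB] at hx'
  have nf := acq_normalForm (c := fun x₂ => f (Fin.append x₁ x₂)) l (hq x₁) hl p q hP' hx'
  have hrow : ∀ i, (fun j => f (Fin.append x₁ zeroVec) ^^ f (Fin.append x₁ (Pi.single i true)) ^^
      f (Fin.append x₁ (Pi.single j true)) ^^ f (Fin.append x₁ (bxor (Pi.single i true) (Pi.single j true)))) =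
      fun j => B x₁ i j := fun i => funext fun j => (hB x₁ i j).symm
  have ha : (fun j => f (Fin.append x₁ (Pi.single j true)) ^^ f (Fin.append x₁ zeroVec) ^^
      ((f (Fin.append x₁ zeroVec) ^^ f (Fin.append x₁ (Pi.single p true)) ^^ f (Fin.append x₁ (Pi.single j true)) ^^
          f (Fin.append x₁ (bxor (Pi.single p true) (Pi.single j true)))) &&
        (f (Fin.append x₁ zeroVec) ^^ f (Fin.append x₁ (Pi.single q true)) ^^ f (Fin.append x₁ (Pi.single j true)) ^^
          f (Fin.append x₁ (bxor (Pi.single q true) (Pi.single j true)))))) =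
      fun j => d x₁ j ^^ (B x₁ p j && B x₁ q j) := funext fun j => by rw [hd, hB, hB]
  rw [hrow p, hrow q, ha] at nf
  have hW := acq_W_aligned' l hl nf
  -- distinctness of the four corners (rows independent)
  have hinj := acv_corner_injective B d hBsymm hBdiag x₁ hpq
  rw [hfib, sum_image fun st _ st' _ e => hinj e, mul_sum]
  refine sum_congr rfl fun st _ => ?_
  obtain ⟨σ, τ⟩ := st
  rw [hW]
  -- evaluate the indicator combination at the corner (σ, τ)
  have val : ((if (fun j => (d x₁ j ^^ (B x₁ p j && B x₁ q j)) ^^ (σ && B x₁ p j) ^^ (τ && B x₁ q j)) =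
        (fun j => d x₁ j ^^ (B x₁ p j && B x₁ q j)) then (1 : ℝ) else 0) +
      (if (fun j => (d x₁ j ^^ (B x₁ p j && B x₁ q j)) ^^ (σ && B x₁ p j) ^^ (τ && B x₁ q j)) =
        bxor (fun j => d x₁ j ^^ (B x₁ p j && B x₁ q j)) (fun j => B x₁ p j) then (1 : ℝ) else 0) +
      (if (fun j => (d x₁ j ^^ (B x₁ p j && B x₁ q j)) ^^ (σ && B x₁ p j) ^^ (τ && B x₁ q j)) =
        bxor (fun j => d x₁ j ^^ (B x₁ p j && B x₁ q j)) (fun j => B x₁ q j) then (1 : ℝ) else 0) -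
      (if (fun j => (d x₁ j ^^ (B x₁ p j && B x₁ q j)) ^^ (σ && B x₁ p j) ^^ (τ && B x₁ q j)) =
        bxor (fun j => d x₁ j ^^ (B x₁ p j && B x₁ q j)) (bxor (fun j => B x₁ p j) (fun j => B x₁ q j)) then (1 : ℝ) else 0))
      = signOf (σ && τ) := by
    -- the corner (σ,τ) equals the corner (σ',τ') iff (σ,τ) = (σ',τ')
    have e00 : (fun j => d x₁ j ^^ (B x₁ p j && B x₁ q j)) =
        (fun j => (d x₁ j ^^ (B x₁ p j && B x₁ q j)) ^^ (false && B x₁ p j) ^^ (false && B x₁ q j)) := by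
      funext j; simp
    have e10 : bxor (fun j => d x₁ j ^^ (B x₁ p j && B x₁ q j)) (fun j => B x₁ p j) =
        (fun j => (d x₁ j ^^ (B x₁ p j && B x₁ q j)) ^^ (true && B x₁ p j) ^^ (false && B x₁ q j)) := by
      funext j; simp [bxor]
    have e01 : bxor (fun j => d x₁ j ^^ (B x₁ p j && B x₁ q j)) (fun j => B x₁ q j) =
        (fun j => (d x₁ j ^^ (B x₁ p j && B x₁ q j)) ^^ (false && B x₁ p j) ^^ (true && B x₁ q j)) := by
      funext j; simp [bxor]
    have e11 : bxor (fun j => d x₁ j ^^ (B x₁ p j && B x₁ q j)) (bxor (fun j => B x₁ p j) (fun j => B x₁ q j)) =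
        (fun j => (d x₁ j ^^ (B x₁ p j && B x₁ q j)) ^^ (true && B x₁ p j) ^^ (true && B x₁ q j)) := by
      funext j; simp [bxor]
    have key : ∀ σ' τ' : Bool, ((fun j => (d x₁ j ^^ (B x₁ p j && B x₁ q j)) ^^ (σ && B x₁ p j) ^^ (τ && B x₁ q j)) =
        (fun j => (d x₁ j ^^ (B x₁ p j && B x₁ q j)) ^^ (σ' && B x₁ p j) ^^ (τ' && B x₁ q j))) ↔ (σ = σ' ∧ τ = τ') := by
      intro σ' τ'
      constructor
      · intro e; exact hinj (a₁ := (σ, τ)) (a₂ := (σ', τ')) e |> fun h => ⟨congrArg Prod.fst h, congrArg Prod.snd h⟩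
      · rintro ⟨rfl, rfl⟩; rfl
    rw [e10, e01, e11, e00]
    simp only [key]
    cases σ <;> cases τ <;> norm_num [signOf]
  dsimp only
  rw [val, signOf_xor, signOf_xor]
  ring

/-- **Mismatches propagate.** For FIXED `(p, q, σ, τ)` the indicator
`μ(x₁) = B_{pq}(x₁) · [h(corner_{στ}(x₁)) ⊕ f(x₁‖0) ⊕ στ]` has degree `≤ 7` in `x₁` (`h` cubic composed with the
quadratic corner map, `f(·‖0)` cubic, `B` affine); so one mismatch forces `2^a ≤ 2^7 · #{μ = 1}` (stub R). -/
theorem acv_mismatch_many (hf : IsDegLeFun 3 f) (hh : IsDegLeFun 3 h)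
    (hB : ∀ x₁ i j, B x₁ i j = (f (Fin.append x₁ zeroVec) ^^ f (Fin.append x₁ (Pi.single i true)) ^^
      f (Fin.append x₁ (Pi.single j true)) ^^ f (Fin.append x₁ (bxor (Pi.single i true) (Pi.single j true)))))
    (hd : ∀ x₁ j, d x₁ j = (f (Fin.append x₁ (Pi.single j true)) ^^ f (Fin.append x₁ zeroVec)))
    (p q : Fin (a + 2)) (σ τ : Bool) (x₀ : Fin a → Bool)
    (hx₀ : (B x₀ p q && (h (fun j => (d x₀ j ^^ (B x₀ p j && B x₀ q j)) ^^ (σ && B x₀ p j) ^^ (τ && B x₀ q j)) ^^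
      f (Fin.append x₀ zeroVec) ^^ (σ && τ))) = true) :
    2 ^ a ≤ 2 ^ 7 * (univ.filter fun x₁ : Fin a → Bool =>
      (B x₁ p q && (h (fun j => (d x₁ j ^^ (B x₁ p j && B x₁ q j)) ^^ (σ && B x₁ p j) ^^ (τ && B x₁ q j)) ^^
        f (Fin.append x₁ zeroVec) ^^ (σ && τ))) = true).card := by
  have hBdeg : ∀ i j, IsDegLeFun 1 (fun x => B x i j) := fun i j =>
    rm_isDegLeFun_congr (acx_deg_polar hf (Pi.single i true) (Pi.single j true)) fun x => (hB x i j).symm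
  have hddeg : ∀ j, IsDegLeFun 2 (fun x => d x j) := fun j =>
    rm_isDegLeFun_congr (acx_deg_first hf (Pi.single j true)) fun x => (hd x j).symm
  have hcdeg : ∀ j, IsDegLeFun 2 (fun x => (d x j ^^ (B x p j && B x q j)) ^^ (σ && B x p j) ^^ (τ && B x q j)) :=
    fun j => fc_deg_bxor (fc_deg_bxor (fc_deg_bxor (hddeg j) (acq_deg_band (hBdeg p j) (hBdeg q j) le_rfl))
      (acq_deg_band (isDegLeFun_const 0 σ) (hBdeg p j) (by norm_num)))
      (acq_deg_band (isDegLeFun_const 0 τ) (hBdeg q j) (by norm_num))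
  have hμdeg : IsDegLeFun 7 (fun x₁ : Fin a → Bool =>
      B x₁ p q && (h (fun j => (d x₁ j ^^ (B x₁ p j && B x₁ q j)) ^^ (σ && B x₁ p j) ^^ (τ && B x₁ q j)) ^^
        f (Fin.append x₁ zeroVec) ^^ (σ && τ))) := by
    refine acq_deg_band (hBdeg p q) (fc_deg_bxor (d := 6) (fc_deg_bxor ?_ (acx_deg_mono (by norm_num) (acx_deg_eval hf zeroVec)))
      (isDegLeFun_const 6 _)) (by norm_num)
    exact fc_isDegLeFun_comp hh (fun x => fun j => (d x j ^^ (B x p j && B x q j)) ^^ (σ && B x p j) ^^ (τ && B x q j))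
      (fun j => hcdeg j) (by norm_num)
  exact stub_rmWeight stub_derivDegree a 7 _ hμdeg ⟨x₀, hx₀⟩

end ZEmpty

/-- Registered helper-stub form (see the module docstring). [folklore] -/
theorem acv_cornerInjectiveStub : ∀ {a : ℕ} (B : (Fin a → Bool) → Fin (a + 2) → Fin (a + 2) → Bool) (d : (Fin a → Bool) → Fin (a + 2) → Bool), (∀ x i j, B x i j = B x j i) → (∀ x i, B x i i = false) → ∀ (x : Fin a → Bool) {p q : Fin (a + 2)}, B x p q = true → Function.Injective (fun st : Bool × Bool => fun j => (d x j ^^ (B x p j && B x q j)) ^^ (st.1 && B x p j) ^^ (st.2 && B x q j)) := by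
  intro a B d hs hd x p q hpq
  exact acv_corner_injective B d hs hd x hpq

end Summit.QuantumAdvantage.QuantumAdvantage.Theorems.CubicForrelation.NearExactIsExact

end
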